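import Summits.Ventures.QEC.CircuitDistance.FibreNullSplit
import HarnessLib

/-!
# Null-split fibre leaves, part 2: cheap coordinate bounds and a row-indexed «isolated null» certificate (CDX, qec-cdx-eng-1)

Kernel-economics helpers for the budget-1 leaf files: the coordinate bound of the appended unit clauses from ONE Boolean fact
`nulls.all (· < n) = true` (instead of a nested `∀ cl ∈ …, ∀ l ∈ cl` decision), and `hc_all_cert`, which checks each non-usable
null against ONE named row (its isolating row) instead of scanning all rows.
-/

namespace Summit.Ventures.QEC.CircuitDistance

open Std.Sat Summit.Ventures.QEC.Census.CNFEncode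

/-- Literals of `nullUnits` are coordinates `< n`. -/
theorem nullUnits_lt (nulls : List ℕ) (n : ℕ) (h : (nulls.all fun c => decide (c < n)) = true) :
    ∀ cl ∈ nullUnits nulls, ∀ l ∈ cl, l.1 < n := by
  intro cl hcl l hl
  obtain ⟨c, hc, rfl⟩ := List.mem_map.1 hcl
  rw [List.mem_singleton] at hl; subst hl
  simpa using List.all_eq_true.1 h c hc

/-- Literals of `nullUnitsExcept` are coordinates `< n` (given `c < n`). -/
theorem nullUnitsExcept_lt (nulls : List ℕ) (n c : ℕ) (hc : c < n) (h : (nulls.all fun c => decide (c < n)) = true) :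
    ∀ cl ∈ nullUnitsExcept nulls c, ∀ l ∈ cl, l.1 < n := by
  intro cl hcl l hl
  simp only [nullUnitsExcept, List.mem_cons, List.mem_map, List.mem_filter] at hcl
  rcases hcl with rfl | ⟨c', ⟨hc'mem, -⟩, rfl⟩
  · rw [List.mem_singleton] at hl; subst hl; exact hc
  · rw [List.mem_singleton] at hl; subst hl
    simpa using List.all_eq_true.1 h c' hc'mem

/-- One row isolates the null `c`: it contains `c`, is duplicate-free, and all its other members are nulls. -/
def isolatedByRow (r : List ℕ) (nulls : List ℕ) (c : ℕ) : Bool :=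
  decide r.Nodup && r.contains c && r.all fun x => x == c || nulls.contains x

/-- A row certificate implies the scanning condition `isolatedNull`. -/
theorem isolatedNull_of_row (rows : List (List ℕ)) (nulls : List ℕ) (c i : ℕ)
    (h : isolatedByRow (rows.getD i []) nulls c = true) : isolatedNull rows nulls c = true := by
  unfold isolatedNull
  rw [List.any_eq_true]
  refine ⟨rows.getD i [], ?_, h⟩
  by_cases hi : i < rows.length
  · rw [List.getD_eq_getElem _ _ hi]; exact List.getElem_mem hi
  · rw [List.getD_eq_default _ _ (Nat.le_of_not_lt hi)] at h
    simp [isolatedByRow] at h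

/-- `hc` over all nulls from the usable ones and a ROW-INDEXED certificate `cert` (aligned with `nulls`: for a non-usable null,
the index of an isolating row). -/
theorem hc_all_cert {n : ℕ} {rows us : List (List ℕ)} {w : ℕ} (nulls usable cert : List ℕ)
    (husable : ∀ c ∈ usable, ¬ ∃ a, SolvesAny n rows us w a ∧ a c = true ∧ ∀ c' ∈ nulls, c' ≠ c → a c' = false)
    (hlen : cert.length = nulls.length)
    (hcert : ((List.zip nulls cert).all fun p => usable.contains p.1 || isolatedByRow (rows.getD p.2 []) nulls p.1) = true) :
    ∀ c ∈ nulls, ¬ ∃ a, SolvesAny n rows us w a ∧ a c = true ∧ ∀ c' ∈ nulls, c' ≠ c → a c' = false := by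
  intro c hc
  obtain ⟨k, hk, rfl⟩ := List.getElem_of_mem hc
  have hk' : k < cert.length := by omega
  have hmem : (nulls[k], cert[k]) ∈ List.zip nulls cert := by
    have := List.getElem_zip (l := nulls) (l' := cert) (i := k) (h := by simp [List.length_zip]; omega)
    rw [← this]; exact List.getElem_mem _
  have := List.all_eq_true.1 hcert _ hmem
  rw [Bool.or_eq_true] at this
  rcases this with h | h
  · exact husable _ (by simpa using h)
  · exact hc_of_isolated nulls _ (isolatedNull_of_row rows nulls _ _ h)

end Summit.Ventures.QEC.CircuitDistance
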